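import Summits.HodgeConjecture.HodgeConjecture.Theorems.Ring2AbelianAllAndreFibreClassDivisorialOfHodgeType
import Literature.AlgebraicGeometry.HodgeTheory.HodgeTypeProjectors
import Literature.AlgebraicGeometry.HodgeTheory.HodgeTypeVanishing
import Literature.AlgebraicGeometry.HodgeTheory.AlgebraicClassesHodgeTypeHolds
import Literature.AlgebraicGeometry.Motives.WeilJacobianDimension
import HarnessLib

/-!
# Ring 2 · sub-cell AbelianAll (ALL ABELIAN VARIETIES), André axis, part XVI-a — RIGIDITY OF THE HODGE TYPE OF
# INVARIANT CLASSES (Deligne, Hodge II, Cor. 4.1.2 / (4.1.3.1) on the carriers) and the divisorial node (N₂) as a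
# property of the PENCIL: (N₂)(t₀) ⟺ "`I₂(t₀)` is of type (1,1)" ⟺ "no class of type (2,0) of the total space
# survives on a fibre" — hence (β′_f) for every compact pencil of abelian surfaces or threefolds whose total
# space has no holomorphic 2-form class restricting non-trivially to a fibre (e.g. `h^{2,0}(𝒳) = 0`)

HONEST FRAMING (page 1, verbatim): **research route, not a corollary; conditional on HC_CM plus one named
minimal statement.** Cell line: research route conditional on HC_CM; not a corollary; Q11.4-sentence-2
already refuted in dim ≥ 3. Nothing in this file proves a case of the Hodge conjecture for an abelian variety.
`HC_CM` = `Theses.RankFourFaces.CMAbelianHodge` (a BINDER elsewhere; it does not occur in this file), item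
`Theses.RankFourFaces.CMToAbelian` (stmt-16267) OPEN and not closed here. Seat `pub-hodge-ring2-ab-andre-2`, gen 8;
owed item (o18) of RING2-MAP §AbelianAll AA2.47/AA2.49/AA2.56 ("the Torelli / isotriviality step for `d = 2` needs
the constancy of the invariant sub-Hodge structure on the carriers") — the constancy is PROVED here, and the
`d ≤ 3` theorems of parts XIV-c/d/h are restated with a hypothesis on the TOTAL SPACE only.

## What is proved (theorems only; no definition, no named fact, no sorry)

§1 (any morphism `g : Y ⟶ X` of smooth projective varieties, Hodge models `A` of `X`, `B` of `Y`):
* `typeProj_map_comm` — the Hodge-type projectors commute with pull-back: `π^B_{(p,q)}(g^* c) = g^*(π^A_{(p,q)} c)`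
  (uniqueness of the type decomposition, `HodgeModel.typeProj_eq_of_sum_eq`, and type preservation of `g^*`).
* `isOfHodgeType_map_iff_forall_typeProj` — `g^* c` is of type `(p,q)`, `p + q = k`, iff `g^*` KILLS every other
  type component `π^A_{(p',q')} c`, `(p',q') ≠ (p,q)`, of `c`.

§2 (compact pencils `f : 𝒳 ⟶ S` of abelian `d`-folds; `j_t : 𝒳_t ↪ 𝒳`):
* **`isOfHodgeType_map_fiberι_iff` — RIGIDITY: for every `W ∈ Hᵏ(𝒳(ℂ); ℂ)` and all `s, t ∈ S(ℂ)`,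
  `j_t^* W` is of type `(p,q)` on `𝒳_t` iff `j_s^* W` is of type `(p,q)` on `𝒳_s`.** Proof: §1 with ONE model
  of `𝒳` and André's flatness (A4) `map_fiberι_eq_zero_of_eq_zero` (a global class dying on one fibre dies on
  all — a tree theorem). This is Deligne's Cor. 4.1.2 ("la structure de Hodge induite sur `H⁰(S, Rⁱf_*ℚ)` est
  indépendante de `s`") / (4.1.3.1) (Griffiths: "si une section globale … est de type de Hodge `(p,q)` en un
  point, alors elle est de type `(p,q)` partout") for the sections coming from the total space — which by the
  tree's `deligne1968_invariantClass_fromTotalSpace_holds` are all of them.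
* `hodgeType_map_fiberι_all_of_at` — the hypothesis "every class of `j_{t₀}^* H²ᵖ(𝒳)` is of type `(p,p)`" of
  part XIV-h holds at every fibre as soon as it holds at one.

§3 (degree 2):
* **`hodgeType_one_one_map_fiberι_iff_twoZero`** — every class of `I₂(t₀) = j_{t₀}^* H²(𝒳)` is of type `(1,1)`
  IFF every class of type `(2,0)` of `𝒳` restricts to `0` on `𝒳_{t₀}` (⟸: decompose `W = W^{2,0}+W^{1,1}+W^{0,2}`,
  the `(0,2)`-part dies by complex conjugation `conjClass_map`; ⟹: a class of types `(2,0)` and `(1,1)` is `0`).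
* **`divisorSpannedInvariantHTwoAt_iff_hodgeType_one_one`, `divisorSpannedInvariantHTwoAt_iff_twoZero_vanish`** —
  THREE-WAY EQUIVALENCE: (N₂ f)(t₀) ⟺ `I₂(t₀) ⊂ H^{1,1}(𝒳_{t₀})` ⟺ `H^{2,0}(𝒳) ⊂ ker j_{t₀}^*` (⟹ of the first:
  algebraic classes are of type `(1,1)`, `isOfHodgeType_of_mem_algebraicClasses_of_isSmoothProjective`; ⟸: part
  XIV-h, Lefschetz (1,1) + semisimplicity). With part XIV-f's `algebraicInvariantClassesAt_of_at` all three are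
  independent of `t₀` (Deligne (4.1.3.1), `n = 2`: "si `a` est en un point `s` la classe d'un diviseur de `X_s`,
  alors `a` est en tout point la classe d'un diviseur et, pour `S` lisse, est même définie par un diviseur `D`
  sur `X`").

§4 (the rows):
* **`fibreClassLefschetzOn_of_twoZero_vanish_of_le_three`** — (β′_f) for every compact pencil of abelian SURFACES or
  THREEFOLDS on which no class of type `(2,0)` of the total space survives on some fibre; in particular
  **`fibreClassLefschetzOn_of_twoZero_eq_zero_of_le_three`** — (β′_f) whenever `h^{2,0}(𝒳) = 0` (no non-zero class
  of type `(2,0)` on `𝒳`); `invariantCyclesHoldFor_…` twins (Abdulali's (1.1) for them).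
* **`divisorSpanned_or_exists_twoZero_surviving` — DICHOTOMY**: on every compact pencil of abelian `d`-folds
  EITHER (N₂) holds (at every fibre) OR some class `η` of type `(2,0)` on `𝒳` restricts to a NON-ZERO class of type
  `(2,0)` on EVERY fibre ("cohomological (2,0)-isotriviality": one global 2-form calibrates all fibres).

(The general degree `2p` and the `h^{2,0} = 1` span statement are in part XVI-b.)

READING (RING2-MAP §AbelianAll gen 8). (i) The typed hypothesis of the d = 2, 3 theorems is now a property of the
pencil, not of a fibre, and lives on the total space: "`H^{2,0}(𝒳) → H^{2,0}(𝒳_t)` is zero". In print, for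
abelian-surface (or K3) fibres (`h^{2,0} = 1`) its failure means one holomorphic 2-form of `𝒳` spans `H^{2,0}` of
every fibre, i.e. the period map is constant — by Torelli the pencil is isotrivial; so the d = 2 theorem covers
every NON-ISOTRIVIAL compact pencil of abelian surfaces, the isotriviality ⟹ Torelli step being the only print
input left (and irrelevant to (β′_f), which holds for isotrivial pencils by the graph of the isotrivialisation).
(ii) (N₂) FAILS exactly on the "(2,0)-surviving" pencils (constant pencils, pencils with a fixed transcendental
part), where by part XV-b any (β′_f)-witness is a non-product cycle. No Hodge-conjecture input anywhere; no
named fact; `HC_CM` does not occur.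

References: DeligneHodgeII1971 (Cor. 4.1.2, (4.1.3.1), Thm. 4.1.1); VoisinHodgeII2003 (§4.3.3 Thm. 4.24,
Cor. 4.25); VoisinHodgeI2002 (§6.1.3 Cor. 6.12, Thm. 6.18, §7.1.1, §7.3.2, §11.3 Thm. 11.30); Voisin2025
(Prop. 2.11); Abdulali1994FamiliesAV (Conj. 5.3, Thm. 5.5 p. 1130); Andre1996Motifs (§5.1 (A4), p. 25).
-/

noncomputable section

set_option linter.dupNamespace false

namespace Summit.HodgeConjecture.HodgeConjecture.Ring2.AbelianAll

open CategoryTheory AlgebraicGeometry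
open Literature.AlgebraicGeometry Literature.AlgebraicGeometry.Motives
open Literature.AlgebraicGeometry.HodgeTheory
open Literature.AlgebraicTopology.SingularHomology (singularCohomology)
open Literature.AlgebraicGeometry.Abdulali1994 (InvariantCyclesHoldFor)

/-! ## §1 Hodge-type projectors commute with pull-backs; the type of a pulled-back class -/

section Morphisms

variable {m n : ℕ} {X Y : SchemeOver ℂ}

/-- Off the antidiagonal a Hodge type is empty: for `p + q ≠ k`, `c ∈ Hᵏ` is of type `(p,q)` iff `c = 0`
(there are no `(p,q)`-forms of degree `k`). [cite: VoisinHodgeI2002, §6.1.3 Thm. 6.18 and §7.1.1] -/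
theorem isOfHodgeType_iff_eq_zero_of_add_ne (hX : IsSmoothProjective n X) {k p q : ℕ} (hpq : p + q ≠ k)
    (c : complexBetti X k) : IsOfHodgeType n X k p q c ↔ c = 0 := by
  obtain ⟨A⟩ := nonempty_hodgeModel_holds hX
  refine ⟨?_, ?_⟩
  · rintro ⟨B, hB⟩
    have hbot : B.hodgePQ k p q = ⊥ :=
      (B.hodgePQ_eq_bot_iff k p q).2 (Literature.NumberTheory.Transcendental.hodgePQ_eq_bot_of_ne hpq)
    rw [hbot, Submodule.mem_bot] at hB
    exact B.pullback_injective k (by rw [hB, map_zero])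
  · rintro rfl
    exact IsOfHodgeType.zero A k p q

/-- The type-`(a, b)` component `π^A_{(a,b)} c` of a class is of Hodge type `(a, b)` (the tree's
`HodgeModel.isOfHodgeType_of_mem_typePiece`, restated with the indices unbundled). [cite: VoisinHodgeI2002, Thm. 6.18 and §7.1.1] -/
theorem isOfHodgeType_typeProj (A : HodgeModel n X) {k a b : ℕ} (hab : (a, b) ∈ Finset.HasAntidiagonal.antidiagonal k)
    (c : complexBetti X k) : IsOfHodgeType n X k a b (A.typeProj k ⟨(a, b), hab⟩ c) := by
  have h := A.isOfHodgeType_of_mem_typePiece (A.typeProj_mem k ⟨(a, b), hab⟩ c)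
  exact h

/-- **The Hodge-type projectors commute with pull-back along a morphism of smooth projective varieties**:
`π^B_{(p,q)}(g^* c) = g^*(π^A_{(p,q)} c)` for Hodge models `A` of `X`, `B` of `Y` and `g : Y ⟶ X` — `g^* c =
∑ g^*(π^A_{(p,q)} c)` is a decomposition into classes of the respective types (`g^*` preserves types, Voisin I
§7.3.2), and the type decomposition on `Y` is unique (Thm. 6.18). [cite: VoisinHodgeI2002, Thm. 6.18 and §7.3.2] -/
theorem typeProj_map_comm (hX : IsSmoothProjective n X) (hY : IsSmoothProjective m Y) (g : Y ⟶ X)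
    (A : HodgeModel n X) (B : HodgeModel m Y) (k : ℕ) (pq : ↥(Finset.HasAntidiagonal.antidiagonal k))
    (c : complexBetti X k) :
    B.typeProj k pq (complexBetti.map g k c) = complexBetti.map g k (A.typeProj k pq c) := by
  refine B.typeProj_eq_of_sum_eq (y := fun pq' ↦ complexBetti.map g k (A.typeProj k pq' c)) ?_ ?_ pq
  · intro pq'
    exact B.mem_typePiece_of_isOfHodgeType hodgePQ_independent_of_hodgeModel_holds hY pq'.2
      ((A.isOfHodgeType_of_mem_typePiece (A.typeProj_mem k pq' c)).map_of_isSmoothProjective hY hX g)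
  · rw [← map_sum, A.sum_typeProj]

/-- **The type of a pulled-back class**: for `g : Y ⟶ X`, a Hodge model `A` of `X` and `p + q = k`, the class
`g^* c` is of type `(p,q)` on `Y` iff `g^*(π^A_{(p',q')} c) = 0` for every `(p',q') ≠ (p,q)` — i.e. iff all OTHER
type components of `c` die under `g^*`. [cite: VoisinHodgeI2002, Thm. 6.18 and §7.3.2] -/
theorem isOfHodgeType_map_iff_forall_typeProj (hX : IsSmoothProjective n X) (hY : IsSmoothProjective m Y)
    (g : Y ⟶ X) (A : HodgeModel n X) {k p q : ℕ} (hpq : p + q = k) (c : complexBetti X k) :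
    IsOfHodgeType m Y k p q (complexBetti.map g k c) ↔
      ∀ pq' : ↥(Finset.HasAntidiagonal.antidiagonal k), pq'.1 ≠ (p, q) →
        complexBetti.map g k (A.typeProj k pq' c) = 0 := by
  obtain ⟨B⟩ := nonempty_hodgeModel_holds hY
  have hmem : (p, q) ∈ Finset.HasAntidiagonal.antidiagonal k := Finset.HasAntidiagonal.mem_antidiagonal.2 hpq
  refine ⟨fun h pq' hne ↦ ?_, fun h ↦ ?_⟩
  · have hcomm := typeProj_map_comm hX hY g A B k pq' c
    rw [← hcomm]
    exact B.typeProj_apply_of_mem_ne (pq := ⟨(p, q), hmem⟩) (fun heq ↦ hne (by rw [← heq]))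
      (B.mem_typePiece_of_isOfHodgeType hodgePQ_independent_of_hodgeModel_holds hY hmem h)
  · have hsum : complexBetti.map g k c = complexBetti.map g k (A.typeProj k ⟨(p, q), hmem⟩ c) := by
      conv_lhs => rw [← A.sum_typeProj k c, map_sum]
      rw [Finset.sum_eq_single ⟨(p, q), hmem⟩]
      · intro pq' _ hne
        exact h pq' fun heq ↦ hne (Subtype.ext heq)
      · intro habs
        exact absurd (Finset.mem_univ _) habs
    rw [hsum]
    exact (A.isOfHodgeType_of_mem_typePiece (A.typeProj_mem k ⟨(p, q), hmem⟩ c)).map_of_isSmoothProjective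
      hY hX g

end Morphisms

variable {𝒳 S : SchemeOver ℂ}

/-! ## §2 Rigidity: the Hodge type of an invariant class does not depend on the fibre -/

/-- **RIGIDITY of the Hodge type of invariant classes (Deligne, Hodge II, Cor. 4.1.2 / (4.1.3.1) on the
carriers).** On a compact pencil `f : 𝒳 ⟶ S` of abelian `d`-folds, for every class `W ∈ Hᵏ(𝒳(ℂ); ℂ)` and all
`s, t ∈ S(ℂ)`: `j_t^* W` is of Hodge type `(p,q)` on `𝒳_t` iff `j_s^* W` is of type `(p,q)` on `𝒳_s`. Proof: read
both in ONE Hodge model `A` of `𝒳` (§1: type `(p,q)` iff the other components `π^A_{(p',q')} W` die on the fibre)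
and move the vanishing between fibres by André's flatness (A4) `map_fiberι_eq_zero_of_eq_zero` (a tree theorem).
"La structure de Hodge induite sur `H⁰(S, Rⁱf_*ℚ)` … est indépendante de `s`"; "(Griffiths) si une section globale
… est de type de Hodge `(p,q)` en un point, alors elle est de type `(p,q)` partout". No named fact.
[cite: DeligneHodgeII1971, Cor. 4.1.2 and (4.1.3.1)] [cite: VoisinHodgeII2003, §4.3.3 Cor. 4.25]
[cite: Andre1996Motifs, §5.1 (p. 25)] -/
theorem isOfHodgeType_map_fiberι_iff {d : ℕ} {f : 𝒳 ⟶ S} (hf : IsCompactAbelianPencil f d) {k p q : ℕ}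
    (W : complexBetti 𝒳 k) (s t : ComplexPoints S) :
    IsOfHodgeType d (fiberOver f t) k p q (complexBetti.map (fiberι f t) k W) ↔
      IsOfHodgeType d (fiberOver f s) k p q (complexBetti.map (fiberι f s) k W) := by
  have h𝒳 := hf.isSmoothProjective_total
  by_cases hpq : p + q = k
  · obtain ⟨A⟩ := nonempty_hodgeModel_holds h𝒳
    rw [isOfHodgeType_map_iff_forall_typeProj h𝒳 (hf.isSmoothProjective_fiberOver t) (fiberι f t) A hpq,
      isOfHodgeType_map_iff_forall_typeProj h𝒳 (hf.isSmoothProjective_fiberOver s) (fiberι f s) A hpq]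
    exact forall₂_congr fun pq' _ ↦
      ⟨fun h ↦ map_fiberι_eq_zero_of_eq_zero hf h s, fun h ↦ map_fiberι_eq_zero_of_eq_zero hf h t⟩
  · rw [isOfHodgeType_iff_eq_zero_of_add_ne (hf.isSmoothProjective_fiberOver t) hpq,
      isOfHodgeType_iff_eq_zero_of_add_ne (hf.isSmoothProjective_fiberOver s) hpq]
    exact ⟨fun h ↦ map_fiberι_eq_zero_of_eq_zero hf h s, fun h ↦ map_fiberι_eq_zero_of_eq_zero hf h t⟩

/-- **Part XIV-h's hypothesis is a property of the pencil**: if every class of `j_{t₀}^* H²ᵖ(𝒳)` is of type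
`(p,p)` on `𝒳_{t₀}`, the same holds at every fibre `s`. [cite: DeligneHodgeII1971, (4.1.3.1)] -/
theorem hodgeType_map_fiberι_all_of_at {d : ℕ} {f : 𝒳 ⟶ S} (hf : IsCompactAbelianPencil f d) {k p q : ℕ}
    {t₀ : ComplexPoints S}
    (h : ∀ W : complexBetti 𝒳 k, IsOfHodgeType d (fiberOver f t₀) k p q (complexBetti.map (fiberι f t₀) k W))
    (s : ComplexPoints S) (W : complexBetti 𝒳 k) :
    IsOfHodgeType d (fiberOver f s) k p q (complexBetti.map (fiberι f s) k W) :=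
  (isOfHodgeType_map_fiberι_iff hf W s t₀).1 (h W)

/-- A global class of type `(p,q)` on `𝒳` restricts to a class of type `(p,q)` on every fibre, which is zero on
one fibre iff it is zero on all of them (type preservation + flatness). [cite: DeligneHodgeII1971, (4.1.3.1)]
[cite: Andre1996Motifs, §5.1 (p. 25)] -/
theorem map_fiberι_ne_zero_of_ne_zero {d : ℕ} {f : 𝒳 ⟶ S} (hf : IsCompactAbelianPencil f d) {k : ℕ}
    {W : complexBetti 𝒳 k} {t₀ : ComplexPoints S} (h : complexBetti.map (fiberι f t₀) k W ≠ 0)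
    (s : ComplexPoints S) : complexBetti.map (fiberι f s) k W ≠ 0 :=
  fun hs ↦ h (map_fiberι_eq_zero_of_eq_zero hf hs t₀)

/-! ## §3 Degree two: (N₂)(t₀) ⟺ `I₂(t₀)` of type (1,1) ⟺ no surviving (2,0)-class of the total space -/

/-- **`I₂(t₀) ⊂ H^{1,1}` iff `H^{2,0}(𝒳) ⊂ ker j_{t₀}^*`.** Every class of `j_{t₀}^* H²(𝒳(ℂ); ℂ)` is of type
`(1,1)` on the fibre iff every class of type `(2,0)` on `𝒳` restricts to `0` on `𝒳_{t₀}`. (⟹) `j^* η` is of types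
`(2,0)` and `(1,1)`, hence `0` (`IsOfHodgeType.eq_zero_of_ne`). (⟸) In a Hodge model `A` of `𝒳`,
`W = π_{(2,0)}W + π_{(1,1)}W + π_{(0,2)}W`; the first dies by hypothesis, the last is the complex conjugate of a
class of type `(2,0)` (Voisin I Cor. 6.12, `IsOfHodgeType.conjClass`) and `j^*` commutes with conjugation
(`conjClass_map`), so it dies too. [cite: VoisinHodgeI2002, §6.1.3 Cor. 6.12 and Thm. 6.18] [cite: DeligneHodgeII1971, (4.1.3.1)] -/
theorem hodgeType_one_one_map_fiberι_iff_twoZero {d : ℕ} {f : 𝒳 ⟶ S} (hf : IsCompactAbelianPencil f d)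
    (t₀ : ComplexPoints S) :
    (∀ W : complexBetti 𝒳 (2 * 1),
        IsOfHodgeType d (fiberOver f t₀) (2 * 1) 1 1 (complexBetti.map (fiberι f t₀) (2 * 1) W)) ↔
      ∀ η : complexBetti 𝒳 (2 * 1), IsOfHodgeType (d + 1) 𝒳 (2 * 1) 2 0 η →
        complexBetti.map (fiberι f t₀) (2 * 1) η = 0 := by
  have h𝒳 := hf.isSmoothProjective_total
  have hXt := hf.isSmoothProjective_fiberOver t₀
  refine ⟨fun h η hη ↦ ?_, fun h W ↦ ?_⟩
  · exact (hη.map_of_isSmoothProjective hXt h𝒳 (fiberι f t₀)).eq_zero_of_ne hXt (h η) (by simp)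
  · obtain ⟨A⟩ := nonempty_hodgeModel_holds h𝒳
    rw [isOfHodgeType_map_iff_forall_typeProj h𝒳 hXt (fiberι f t₀) A (show 1 + 1 = 2 * 1 by rfl)]
    rintro ⟨⟨a, b⟩, hab⟩ hne
    have hab' : a + b = 2 := by simpa using Finset.HasAntidiagonal.mem_antidiagonal.1 hab
    simp only [ne_eq, Prod.mk.injEq] at hne
    have htyp : IsOfHodgeType (d + 1) 𝒳 (2 * 1) a b (A.typeProj (2 * 1) ⟨(a, b), hab⟩ W) :=
      isOfHodgeType_typeProj A hab W
    rcases Nat.lt_trichotomy a 1 with ha | rfl | ha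
    · -- `(a, b) = (0, 2)`: the conjugate is of type `(2, 0)`
      obtain rfl : a = 0 := by omega
      obtain rfl : b = 2 := by omega
      have hc := h _ (htyp.conjClass h𝒳)
      set η' := A.typeProj (2 * 1) ⟨(0, 2), hab⟩ W with hη'
      have key : complexBetti.map (fiberι f t₀) (2 * 1)
          (conjClass (ComplexPoints 𝒳) (2 * 1) (conjClass (ComplexPoints 𝒳) (2 * 1) η')) = 0 := by
        rw [complexBetti.map, ← conjClass_map, hc, conjClass_zero]
      rwa [conjClass_conjClass] at key
    · exact (hne ⟨rfl, by omega⟩).elim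
    · -- `(a, b) = (2, 0)`
      obtain rfl : a = 2 := by omega
      obtain rfl : b = 0 := by omega
      exact h _ htyp

/-- **(N₂ f)(t₀) ⟹ `I₂(t₀) ⊂ H^{1,1}`**: if the invariant `H²` at `t₀` is divisor-spanned, every class of
`j_{t₀}^* H²(𝒳)` is of type `(1,1)` (algebraic classes are of type `(p,p)`, a tree theorem, and `j^*` preserves
types). [cite: VoisinHodgeI2002, §11.3 Prop. 11.20 and §7.3.2] -/
theorem hodgeType_one_one_map_fiberι_of_divisorSpannedInvariantHTwoAt {d : ℕ} {f : 𝒳 ⟶ S}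
    (hf : IsCompactAbelianPencil f d) {t₀ : ComplexPoints S} (hN : DivisorSpannedInvariantHTwoAt hf t₀)
    (W : complexBetti 𝒳 (2 * 1)) :
    IsOfHodgeType d (fiberOver f t₀) (2 * 1) 1 1 (complexBetti.map (fiberι f t₀) (2 * 1) W) := by
  obtain ⟨D, hD, hDW⟩ := hN W
  rw [← hDW]
  exact (isOfHodgeType_of_mem_algebraicClasses_of_isSmoothProjective hf.isSmoothProjective_total 1 hD)
    |>.map_of_isSmoothProjective (hf.isSmoothProjective_fiberOver t₀) hf.isSmoothProjective_total (fiberι f t₀)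

/-- **(N₂ f)(t₀) ⟺ `I₂(t₀) ⊂ H^{1,1}(𝒳_{t₀})`** — the divisorial node of part XIV-f is EXACTLY the Hodge-type
condition of part XIV-h (⟸: semisimplicity + Lefschetz (1,1), part XIV-h; ⟹: the previous theorem). No rationality
restriction on `W` is needed. [cite: VoisinHodgeI2002, §11.3 Thm. 11.30 and Prop. 11.20] [cite: Voisin2025, Prop. 2.11] -/
theorem divisorSpannedInvariantHTwoAt_iff_hodgeType_one_one {d : ℕ} {f : 𝒳 ⟶ S}
    (hf : IsCompactAbelianPencil f d) (t₀ : ComplexPoints S) :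
    DivisorSpannedInvariantHTwoAt hf t₀ ↔ ∀ W : complexBetti 𝒳 (2 * 1),
      IsOfHodgeType d (fiberOver f t₀) (2 * 1) 1 1 (complexBetti.map (fiberι f t₀) (2 * 1) W) :=
  ⟨fun hN W ↦ hodgeType_one_one_map_fiberι_of_divisorSpannedInvariantHTwoAt hf hN W,
    fun h ↦ divisorSpannedInvariantHTwoAt_of_hodgeType_one_one hf t₀ fun W _ ↦ h W⟩

/-- **(N₂ f)(t₀) ⟺ `H^{2,0}(𝒳) ⊂ ker j_{t₀}^*`** — the divisorial node as a condition on the TOTAL SPACE: the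
invariant `H²` at `t₀` is divisor-spanned iff no class of type `(2,0)` of `𝒳` survives restriction to `𝒳_{t₀}`.
Deligne (4.1.3.1), `n = 2`: a global section which is a divisor class at one fibre is defined by a divisor on the
total space. [cite: DeligneHodgeII1971, (4.1.3.1)] [cite: VoisinHodgeI2002, §11.3 Thm. 11.30] -/
theorem divisorSpannedInvariantHTwoAt_iff_twoZero_vanish {d : ℕ} {f : 𝒳 ⟶ S}
    (hf : IsCompactAbelianPencil f d) (t₀ : ComplexPoints S) :
    DivisorSpannedInvariantHTwoAt hf t₀ ↔ ∀ η : complexBetti 𝒳 (2 * 1), IsOfHodgeType (d + 1) 𝒳 (2 * 1) 2 0 η →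
      complexBetti.map (fiberι f t₀) (2 * 1) η = 0 :=
  (divisorSpannedInvariantHTwoAt_iff_hodgeType_one_one hf t₀).trans (hodgeType_one_one_map_fiberι_iff_twoZero hf t₀)

/-- **(N₂) is a property of the pencil**: (N₂ f)(t₀) ⟺ (N₂ f)(s) for all fibres (part XIV-f's
`algebraicInvariantClassesAt_of_at`, recorded as an `iff`). [cite: DeligneHodgeII1971, (4.1.3.1)] -/
theorem divisorSpannedInvariantHTwoAt_iff_of_fibre {d : ℕ} {f : 𝒳 ⟶ S} (hf : IsCompactAbelianPencil f d)
    (s t₀ : ComplexPoints S) : DivisorSpannedInvariantHTwoAt hf t₀ ↔ DivisorSpannedInvariantHTwoAt hf s :=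
  ⟨fun h ↦ algebraicInvariantClassesAt_of_at hf h s, fun h ↦ algebraicInvariantClassesAt_of_at hf h t₀⟩

/-- The surviving-(2,0)-class condition is likewise independent of the fibre: `H^{2,0}(𝒳) ⊂ ker j_{t₀}^*` iff
`H^{2,0}(𝒳) ⊂ ker j_s^*`. [cite: DeligneHodgeII1971, (4.1.3.1)] [cite: Andre1996Motifs, §5.1 (p. 25)] -/
theorem twoZero_vanish_iff_of_fibre {d : ℕ} {f : 𝒳 ⟶ S} (hf : IsCompactAbelianPencil f d)
    (s t₀ : ComplexPoints S) :
    (∀ η : complexBetti 𝒳 (2 * 1), IsOfHodgeType (d + 1) 𝒳 (2 * 1) 2 0 η →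
        complexBetti.map (fiberι f t₀) (2 * 1) η = 0) ↔
      ∀ η : complexBetti 𝒳 (2 * 1), IsOfHodgeType (d + 1) 𝒳 (2 * 1) 2 0 η →
        complexBetti.map (fiberι f s) (2 * 1) η = 0 :=
  forall₂_congr fun _ _ ↦
    ⟨fun h ↦ map_fiberι_eq_zero_of_eq_zero hf h s, fun h ↦ map_fiberι_eq_zero_of_eq_zero hf h t₀⟩

/-! ## §4 The rows: (β′_f) for `d ≤ 3` from the total space; the dichotomy -/

/-- **(β′_f) for every compact pencil of abelian SURFACES or THREEFOLDS on which no `(2,0)`-class of the total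
space survives on a fibre.** Parts XIV-c/d/g/h with §3: the hypothesis gives (N₂ f)(t₀), and (β′_f) follows for
`d ≤ 3` (`fibreClassLefschetzOn_of_divisorSpanned_of_le_three`). No Hodge-conjecture input, no named fact, no
`HC_CM`. [cite: Abdulali1994FamiliesAV, Conjecture 5.3 and Theorem 5.5 (p. 1130)] [cite: DeligneHodgeII1971, (4.1.3.1)] -/
theorem fibreClassLefschetzOn_of_twoZero_vanish_of_le_three {d : ℕ} {f : 𝒳 ⟶ S} (hf : IsCompactAbelianPencil f d)
    (hd : d ≤ 3) (t₀ : ComplexPoints S)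
    (h : ∀ η : complexBetti 𝒳 (2 * 1), IsOfHodgeType (d + 1) 𝒳 (2 * 1) 2 0 η →
      complexBetti.map (fiberι f t₀) (2 * 1) η = 0) :
    FibreClassLefschetzOn hf :=
  fibreClassLefschetzOn_of_divisorSpanned_of_le_three hf hd t₀
    ((divisorSpannedInvariantHTwoAt_iff_twoZero_vanish hf t₀).2 h)

/-- **(β′_f) for every compact pencil of abelian surfaces or threefolds whose total space carries no non-zero
class of type (2,0)** (`h^{2,0}(𝒳) = 0`). [cite: Abdulali1994FamiliesAV, Conjecture 5.3 (p. 1130)] [cite: DeligneHodgeII1971, (4.1.3.1)] -/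
theorem fibreClassLefschetzOn_of_twoZero_eq_zero_of_le_three {d : ℕ} {f : 𝒳 ⟶ S} (hf : IsCompactAbelianPencil f d)
    (hd : d ≤ 3) (h : ∀ η : complexBetti 𝒳 (2 * 1), IsOfHodgeType (d + 1) 𝒳 (2 * 1) 2 0 η → η = 0) :
    FibreClassLefschetzOn hf := by
  -- a point of the (infinite) base curve
  haveI : IsIntegral S.left := IsSmoothProjective.isIntegral_holds hf.isSmoothProjective_base
  haveI : SmoothOfRelativeDimension 1 S.hom := hf.isSmoothProjective_base.smoothOfRelativeDimension
  haveI : Infinite (ComplexPoints S) := Motives.infinite_algPoints S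
  obtain ⟨t₀⟩ := (inferInstance : Infinite (ComplexPoints S)).nonempty
  exact fibreClassLefschetzOn_of_twoZero_vanish_of_le_three hf hd t₀ fun η hη ↦ by rw [h η hη, map_zero]

/-- Abdulali's invariant-cycles statement (1.1) for the same pencils (part VIII's engine).
[cite: Abdulali1994FamiliesAV, Theorem 5.5 (p. 1130)] -/
theorem invariantCyclesHoldFor_of_twoZero_vanish_of_le_three {d : ℕ} {f : 𝒳 ⟶ S}
    (hf : IsCompactAbelianPencil f d) (hd : d ≤ 3) (t₀ : ComplexPoints S)
    (h : ∀ η : complexBetti 𝒳 (2 * 1), IsOfHodgeType (d + 1) 𝒳 (2 * 1) 2 0 η →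
      complexBetti.map (fiberι f t₀) (2 * 1) η = 0) :
    InvariantCyclesHoldFor f d :=
  invariantCyclesHoldFor_of_fibreClassLefschetzOn hf (fibreClassLefschetzOn_of_twoZero_vanish_of_le_three hf hd t₀ h)

/-- **DICHOTOMY.** On every compact pencil of abelian `d`-folds EITHER (N₂) holds (at the given fibre, hence at
all) OR some class `η` of type `(2,0)` on the total space restricts to a NON-ZERO class of type `(2,0)` on EVERY
fibre — "one global holomorphic 2-form class calibrates all fibres" (cohomological (2,0)-isotriviality; for
abelian-surface fibres, in print, a constant period map). [cite: DeligneHodgeII1971, (4.1.3.1)] [cite: VoisinHodgeI2002, §7.3.2] -/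
theorem divisorSpanned_or_exists_twoZero_surviving {d : ℕ} {f : 𝒳 ⟶ S} (hf : IsCompactAbelianPencil f d)
    (t₀ : ComplexPoints S) :
    DivisorSpannedInvariantHTwoAt hf t₀ ∨
      ∃ η : complexBetti 𝒳 (2 * 1), IsOfHodgeType (d + 1) 𝒳 (2 * 1) 2 0 η ∧ ∀ s : ComplexPoints S,
        complexBetti.map (fiberι f s) (2 * 1) η ≠ 0 ∧
          IsOfHodgeType d (fiberOver f s) (2 * 1) 2 0 (complexBetti.map (fiberι f s) (2 * 1) η) := by
  by_cases h : ∀ η : complexBetti 𝒳 (2 * 1), IsOfHodgeType (d + 1) 𝒳 (2 * 1) 2 0 η →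
      complexBetti.map (fiberι f t₀) (2 * 1) η = 0
  · exact Or.inl ((divisorSpannedInvariantHTwoAt_iff_twoZero_vanish hf t₀).2 h)
  · simp only [not_forall] at h
    obtain ⟨η, hη, hne⟩ := h
    exact Or.inr ⟨η, hη, fun s ↦ ⟨map_fiberι_ne_zero_of_ne_zero hf hne s,
      hη.map_of_isSmoothProjective (hf.isSmoothProjective_fiberOver s) hf.isSmoothProjective_total (fiberι f s)⟩⟩

/-- **(β′_f) OR a calibrating 2-form, for `d ≤ 3`.** [cite: Abdulali1994FamiliesAV, Conjecture 5.3 (p. 1130)] [cite: DeligneHodgeII1971, (4.1.3.1)] -/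
theorem fibreClassLefschetzOn_or_exists_twoZero_surviving {d : ℕ} {f : 𝒳 ⟶ S} (hf : IsCompactAbelianPencil f d)
    (hd : d ≤ 3) (t₀ : ComplexPoints S) :
    FibreClassLefschetzOn hf ∨
      ∃ η : complexBetti 𝒳 (2 * 1), IsOfHodgeType (d + 1) 𝒳 (2 * 1) 2 0 η ∧ ∀ s : ComplexPoints S,
        complexBetti.map (fiberι f s) (2 * 1) η ≠ 0 ∧
          IsOfHodgeType d (fiberOver f s) (2 * 1) 2 0 (complexBetti.map (fiberι f s) (2 * 1) η) :=
  (divisorSpanned_or_exists_twoZero_surviving hf t₀).imp_left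
    (fibreClassLefschetzOn_of_divisorSpanned_of_le_three hf hd t₀)

end Summit.HodgeConjecture.HodgeConjecture.Ring2.AbelianAll

end
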